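import Summits.QuantumFields.BalabanUV.T4Continuum.Spine.NE3.FrameNormalisationAdmissibleGauge
import HarnessLib

/-!
# T⁴ programme, node NE3 — census R50, BY MEMBER: what the zeroth-order frame gauge delivers of `LandauRepB8Avg` — `unitary`, `periodic`, `skew`, `per`, `rep`, `dbar` EXACTLY,
# `sup` at (0)-size; NOT `landau`, `grad`, `holder`, `lap` (`FrameNormalisationMembers`)

Cell `pub-balaban-gaps` (track G2, seat ne3, generation 11), row NE3; census `HOME/ne/NE3.md` §4 R50, §17.  THE END of record rests on `PairLandauGaugeB8Avg` — per pair, a gauge `u`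
and a direction `Z` with the eleven members of `PairLandauB8Avg.LandauRepB8Avg` (`unitary`, `periodic`, `skew`, `per`, `rep`, `landau`, `sup`, `grad`, `holder`, `lap`, `dbar`).
`FrameNormalisationAdmissibleGauge.exists_admissibleFrameNormalised_pair` constructs, from a pinned unitary periodic pre-gauge at a pair, the admissible zeroth-order frame gauge
`u = v·u₀` with the start-frame perturbation `U′ = (e^{B})^{v}`, (1.37), and the output letter `‖U′(b) − 1‖ ≤ ρ := r + 128·d·L^k·b`.  This module reads that output in
`LandauRepB8Avg`'s LITERAL vocabulary, member by member, with the END-framed direction `Z(b) := Ad_{W(b)⁻¹}(log U′(b))` (`FrameNormalisation.relPert_Ad_inv_mlog`):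

* §1 `Z`-bookkeeping for `Z := Ad_{W⁻¹}(log U′)`: `isSkewDir_AdInvMlog` (unitary `W`, `U′` with `‖U′ − 1‖ ≤ 1∕4`: `log` of a unitary is skew, `B7Prop2Explicit.star_mlog_eq_neg`, and
  `Ad` by a unitary preserves skewness, `AveragingDeficitTransport.Ad_mem_skewAdjoint`), `isPeriodicDir_AdInvMlog` (periodic `W`, `U′`), `norm_AdInvMlog_le` (`‖Z(b)‖ ≤ 2‖U′(b) − 1‖`,
  `MatrixLog.norm_mlog_le_two_mul` + `norm_Ad_of_unitary`).
* §2 **`members_of_pair`** — in the regime of `exists_admissibleFrameNormalised_pair` with `ρ ≤ 1∕4`: there are `u`, `Z` with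
  `IsUnitarySite u ∧ IsPeriodicSite u (N·L^k) ∧ IsSkewDir Z ∧ IsPeriodicDir Z (N·L^k) ∧ gaugeAct u U_A = vary W Z 1 ∧ dbavgCovIter L W (relPert W Z) k = 1 ∧ ∀ b, ‖Z(b)‖ ≤ 2ρ` —
  i.e. the members `unitary`, `periodic`, `skew`, `per`, `rep`, `dbar` of `LandauRepB8Avg L N k W U_A u Z s₁ s₂ β` hold EXACTLY, and `sup` holds with the (0)-size constant `2ρ =
  2r + 256·d·L^k·b` (at `b = s₁ξ`, `ξ = L^{−k}`: `2r + 256·d·s₁`) in place of the (−1)-size `s₁·ξ^k`.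

WHAT THIS IS NOT (honest, located).  The four REGULARITY members are NOT delivered: `landau` ((1.38) — the owner lineage's brick E′, `CurvedLandauRep`), `grad` ∕ `holder` ([B8] Prop. 3 ∕
Lemmas 3–4 TYPE) and `lap` ((1.39), idle in THE END's chain — census R52); and `sup` is delivered at the WRONG SIZE ((0) instead of (−1)): exactly the located limit of the piecewise
covariantly-constant realisation (face jumps), whose repair is census R50's open half (M1: smooth corner interpolation + joint fixed point with (1.38), [B8] Sect. E (1.100)) or the
synthesis R53.  So this file is a BY-MEMBER LEDGER of the zeroth order, not a proof of `LandauRepB8Avg`; nothing of Bałaban's is asserted (group algebra, the matrix logarithm on the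
`‖U′ − 1‖ ≤ 1∕4` ball, bookkeeping over landed theorems BY NAME).  **NE3 NOT proved**; `PairLandauGaugeB8Avg` and the covariant root NOT proved; spine PROVED 0∕9; finite T⁴ rung
(B)+1 — NOT continuum YM on ℝ⁴, NOT infinite volume, NOT mass gap, NOT `BetaPertH`, NOT Clay.  HONEST DEPENDENCY: continuum YM on T⁴ ⇐ BetaPertH ∧ nine spine estimates (0/9
proved); BetaPertH ⇐ (D1) ∧ (D4) ∧ CAP+tail; G-an2-4 gates asym, D1 and NE2/3/4.  PLACEMENT: `Summits/QuantumFields/BalabanUV/T4Continuum/Spine/NE3/`; imports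
`FrameNormalisationAdmissibleGauge` only.

References: [Balaban1985Averaging] T. Bałaban, *Averaging operations for lattice gauge theories*, CMP 98 (1985) 17–51: (21) p. 21, (55) p. 27, (96)–(99) p. 32;
[Balaban1985RegularSpaces] T. Bałaban, *Spaces of regular gauge field configurations on a lattice and gauge fixing conditions*, CMP 99 (1985) 75–102: Thm 2 (1.36)–(1.39) p. 82.
-/

set_option autoImplicit false

open scoped BigOperators Matrix Matrix.Norms.L2Operator
open NormedSpace

namespace Summit.QuantumFields.BalabanUV.T4Continuum.NE3.FrameNormalisationMembers

open Literature.MathematicalPhysics.QuantumFieldTheory.Balaban1983to89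
open B7Prop1Explicit B7Prop2Explicit B7Prop3Flat MatrixLog
open B7AvgGaugeCovariance (uLev)
open B7Eq92Concrete (mgauge vcov dbavgCovIter)
open T4AveragingDeficitWall (Ad vary IsSkewDir)
open AveragingDeficitTransport (Ad_mem_skewAdjoint norm_Ad_of_unitary)
open AveragingDeficitPeriodicCounting (IsPeriodicDir)
open NE3EnergyShapes (IsUnitarySite IsPeriodicSite)
open NE3.PairLandauB8Avg (relPert relPert_mul_eq_vary)
open NE3.FrameNormalisation (relPert_Ad_inv_mlog)
open NE3.FrameNormalisationAdmissibleGauge (exists_admissibleFrameNormalised_pair)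

noncomputable section

variable {d : ℕ} {n : Type*} [Fintype n] [DecidableEq n]

/-! ## §1 The END-framed direction `Z := Ad_{W⁻¹}(log U′)`: skew, periodic, `‖Z‖ ≤ 2‖U′ − 1‖` -/

/-- **`Ad_{W(b)⁻¹}(log U′(b))` IS SKEW** for unitary `W(b)`, `U′(b)` with `‖U′(b) − 1‖ ≤ 1∕4`: the logarithm of a unitary near `1` is skew-adjoint (`star_mlog_eq_neg`) and `Ad` by a
unitary preserves skew-adjointness (`Ad_mem_skewAdjoint`). [folklore] -/
theorem isSkewDir_AdInvMlog {W U' : Site d → Fin d → (Matrix n n ℂ)ˣ}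
    (hWu : ∀ (x : Site d) (κ : Fin d), W x κ ∈ unitaryUnits (Matrix n n ℂ)) (hUu : ∀ (x : Site d) (κ : Fin d), U' x κ ∈ unitaryUnits (Matrix n n ℂ))
    (hU : ∀ (x : Site d) (κ : Fin d), ‖((U' x κ : (Matrix n n ℂ)ˣ) : Matrix n n ℂ) - 1‖ ≤ 1 / 4) :
    IsSkewDir (fun x κ => Ad (W x κ)⁻¹ (mlog ((U' x κ : (Matrix n n ℂ)ˣ) : Matrix n n ℂ))) := by
  letI : CStarAlgebra (Matrix n n ℂ) := {}
  intro x κ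
  refine Ad_mem_skewAdjoint ((unitaryUnits (Matrix n n ℂ)).inv_mem (hWu x κ)) ?_
  rw [skewAdjoint.mem_iff]
  exact star_mlog_eq_neg (mem_unitaryUnits.mp (hUu x κ)) (hU x κ)

/-- **`Ad_{W⁻¹}(log U′)` IS `P`-PERIODIC** for `P`-periodic `W`, `U′`. [folklore] -/
theorem isPeriodicDir_AdInvMlog {W U' : Site d → Fin d → (Matrix n n ℂ)ˣ} {P : ℤ}
    (hWP : ∀ (x : Site d) (κ : Fin d) (j : Fin d), W (x + P • e j) κ = W x κ) (hUP : ∀ (x : Site d) (κ : Fin d) (j : Fin d), U' (x + P • e j) κ = U' x κ) :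
    IsPeriodicDir (fun x κ => Ad (W x κ)⁻¹ (mlog ((U' x κ : (Matrix n n ℂ)ˣ) : Matrix n n ℂ))) P := by
  intro x j μ
  simp only [hWP x μ j, hUP x μ j]

/-- **`‖Ad_{W(b)⁻¹}(log U′(b))‖ ≤ 2‖U′(b) − 1‖`** for unitary `W(b)` and `‖U′(b) − 1‖ ≤ 1∕2` (`Ad` by a unitary is an isometry; `‖log X‖ ≤ 2‖X − 1‖` on that ball). [folklore] -/
theorem norm_AdInvMlog_le {W U' : Site d → Fin d → (Matrix n n ℂ)ˣ}
    (hWu : ∀ (x : Site d) (κ : Fin d), W x κ ∈ unitaryUnits (Matrix n n ℂ))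
    (hU : ∀ (x : Site d) (κ : Fin d), ‖((U' x κ : (Matrix n n ℂ)ˣ) : Matrix n n ℂ) - 1‖ ≤ 1 / 2) (x : Site d) (κ : Fin d) :
    ‖Ad (W x κ)⁻¹ (mlog ((U' x κ : (Matrix n n ℂ)ˣ) : Matrix n n ℂ))‖ ≤ 2 * ‖((U' x κ : (Matrix n n ℂ)ˣ) : Matrix n n ℂ) - 1‖ := by
  rw [norm_Ad_of_unitary ((unitaryUnits (Matrix n n ℂ)).inv_mem (hWu x κ))]
  exact norm_mlog_le_two_mul (hU x κ)

/-! ## §2 The by-member ledger at a pair -/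

/-- **WHAT THE ZEROTH-ORDER FRAME GAUGE DELIVERS OF `LandauRepB8Avg`, BY MEMBER** (pinned unitary periodic pre-gauge at a level-`k` pair, regime of
`FrameNormalisationAdmissibleGauge.exists_admissibleFrameNormalised_pair`, output letter `ρ := r + 128·d·L^k·b ≤ 1∕4`): with `u := v·u₀` and `Z := Ad_{W⁻¹}(log (e^{B})^{v})` —
**`unitary`** `IsUnitarySite u`, **`periodic`** `IsPeriodicSite u (N·L^k)`, **`skew`** `IsSkewDir Z`, **`per`** `IsPeriodicDir Z (N·L^k)`, **`rep`** `gaugeAct u U_A = vary W Z 1`,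
**`dbar`** `dbavgCovIter L W (relPert W Z) k = 1` hold EXACTLY, and **`sup`** holds AT (0)-SIZE: `‖Z(b)‖ ≤ 2ρ`.  (`landau`, `grad`, `holder`, `lap` are NOT delivered.) [folklore] -/
theorem members_of_pair [Nonempty n] (hd : 1 ≤ d) {L : ℕ} (hL : 2 ≤ L) (k N : ℕ)
    {u₀ : Site d → (Matrix n n ℂ)ˣ} {UA W V : Site d → Fin d → (Matrix n n ℂ)ˣ} {B : Site d → Fin d → Matrix n n ℂ} {α₀ αP b r : ℝ}
    (hWu : ∀ (x : Site d) (κ : Fin d), W x κ ∈ unitaryUnits (Matrix n n ℂ))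
    (hWP : ∀ (x : Site d) (κ : Fin d) (j : Fin d), W (x + ((N * L ^ k : ℕ) : ℤ) • e j) κ = W x κ)
    (hBu : ∀ (x : Site d) (κ : Fin d), expCfg B x κ ∈ unitaryUnits (Matrix n n ℂ))
    (hBP : ∀ (x : Site d) (κ : Fin d) (j : Fin d), expCfg B (x + ((N * L ^ k : ℕ) : ℤ) • e j) κ = expCfg B x κ)
    (hBr : ∀ (x : Site d) (κ : Fin d), ‖((expCfg B x κ : (Matrix n n ℂ)ˣ) : Matrix n n ℂ) - 1‖ ≤ r)
    (hα : 0 < α₀) (hα3 : C0 d * α₀ ≤ 1 / 3) (hα4 : 4 * α₀ ≤ c2' d L) (h52 : pdev W < α₀ * (((L : ℝ) ^ k)⁻¹) ^ 2)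
    (hb : 0 ≤ b) (hB : ∀ (x : Site d) (κ : Fin d), ‖B x κ‖ ≤ b)
    (hsmall : Real.exp (4 * (800 * ((d : ℝ) + 1) ^ 2 * ((d : ℝ) + 4)) * α₀) * (1 + 8 * (131072 * ((d : ℝ) + 1) ^ 2) * ((L : ℝ) ^ k * b)) ≤ 2)
    (hc₃ : 2 * ((L : ℝ) ^ k * b) ≤ c3 d L) (hsm : 2048 * (d : ℝ) * ((L : ℝ) ^ k * b) ≤ 1)
    (hαP : 0 < αP) (hαP3 : C0 d * αP ≤ 1 / 3) (hαP2 : 2 * αP ≤ c2' d L) (hP : pdev (expCfg B * W) < αP * (((L : ℝ) ^ k)⁻¹) ^ 2)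
    (hu₀u : ∀ x : Site d, u₀ x ∈ unitaryUnits (Matrix n n ℂ))
    (hu₀P : ∀ (x : Site d) (j : Fin d), u₀ (x + ((N * L ^ k : ℕ) : ℤ) • e j) = u₀ x)
    (hu₀c : ∀ z : Site d, u₀ (((L : ℤ) ^ k) • z) = 1) (hrep₀ : gaugeAct u₀ UA = expCfg B * W)
    (hA : avgIter L UA k = V) (hW : avgIter L W k = V) (hρ : r + 128 * (d : ℝ) * ((L : ℝ) ^ k * b) ≤ 1 / 4) :
    ∃ (u : Site d → (Matrix n n ℂ)ˣ) (Z : Site d → Fin d → Matrix n n ℂ),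
      IsUnitarySite u ∧ IsPeriodicSite u ((N * L ^ k : ℕ) : ℤ) ∧ IsSkewDir Z ∧ IsPeriodicDir Z ((N * L ^ k : ℕ) : ℤ) ∧
      gaugeAct u UA = vary W Z 1 ∧ dbavgCovIter L W (relPert W Z) k = 1 ∧
      ∀ (x : Site d) (κ : Fin d), ‖Z x κ‖ ≤ 2 * (r + 128 * (d : ℝ) * ((L : ℝ) ^ k * b)) := by
  obtain ⟨v, -, -, -, hu, hp, hUu, hUp, hUr, hrep, -, hdbar⟩ := exists_admissibleFrameNormalised_pair hd hL k N hWu hWP hBu hBP hBr hα hα3 hα4 h52 hb hB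
    hsmall hc₃ hsm hαP hαP3 hαP2 hP hu₀u hu₀P hu₀c hrep₀ hA hW
  set U' := mgauge W v (expCfg B) with hU'
  have h4 : ∀ (x : Site d) (κ : Fin d), ‖((U' x κ : (Matrix n n ℂ)ˣ) : Matrix n n ℂ) - 1‖ ≤ 1 / 4 := fun x κ => (hUr x κ).trans hρ
  have h2 : ∀ (x : Site d) (κ : Fin d), ‖((U' x κ : (Matrix n n ℂ)ˣ) : Matrix n n ℂ) - 1‖ ≤ 1 / 2 := fun x κ => (h4 x κ).trans (by norm_num)
  have h1 : ∀ (x : Site d) (κ : Fin d), ‖((U' x κ : (Matrix n n ℂ)ˣ) : Matrix n n ℂ) - 1‖ < 1 := fun x κ => (h2 x κ).trans_lt (by norm_num)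
  have hZ := relPert_Ad_inv_mlog (W := W) h1
  refine ⟨v * u₀, fun x κ => Ad (W x κ)⁻¹ (mlog ((U' x κ : (Matrix n n ℂ)ˣ) : Matrix n n ℂ)), hu, hp, isSkewDir_AdInvMlog hWu hUu h4,
    isPeriodicDir_AdInvMlog hWP hUp, ?_, ?_, fun x κ => (norm_AdInvMlog_le hWu h2 x κ).trans (by linarith [hUr x κ])⟩
  · rw [← relPert_mul_eq_vary, hZ]; exact hrep
  · rw [hZ]; exact hdbar

end

end Summit.QuantumFields.BalabanUV.T4Continuum.NE3.FrameNormalisationMembers
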